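import Literature.MathematicalPhysics.QuantumFieldTheory.Balaban1983to89.B13Sect1Statements
import Literature.MathematicalPhysics.QuantumFieldTheory.Balaban1983to89.B13Lemma1Assembly
import Literature.MathematicalPhysics.QuantumFieldTheory.Balaban1983to89.B13Ineq140
import Literature.MathematicalPhysics.QuantumFieldTheory.Balaban1983to89.B13Ineq230Printed

/-!
# `Balaban1983to89.B13Carve28Lemmas1to2Hyp` — T. Bałaban, *Renormalization group approach to lattice gauge field
# theories. II. Cluster expansions*, Commun. Math. Phys. **116** (1988) 1–22 [Balaban1988RG2Cluster]: pp. 8–11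
# (Sect. 1, part 2: (1.26)–(1.43), Lemma 1 (1.33)–(1.36) p. 9, Lemma 2 (1.41)–(1.43) p. 11) — the residual printed
# statements in hypothesis form and ONE bundle keyed to the consumer

statement-level skeleton of published theorems with citation tags; proofs where landed; nothing here is a claim about the
Yang–Mills mass gap

PDF held: `paper:balaban1988-cmp116-rg-ii-cluster` (journal page = PDF page); pp. 8–11 READ AS IMAGES by this seat on the
renders `run/shared/lean/pub/pub-balaban/b2b-balaban-ref1/pages/1988-cmp116-rg-II-cluster/…-p008…p011-x2.png`
(2026-08-28); the text layer (`lit read … --pages 7-12`, files `p0008.txt` … `p0011.txt`) is used only for the line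
locators `p. N l. m` below.  References of [II] are those of [I] = [Balaban1987RG1]: (I.3.7), (I.3.21), (I.3.34) are
displays of [I]; «(80) [15]», «(33), (37), (55), (57), (58) [15]» are displays of [Balaban1985Averaging].

CITATION HEADER (lean-in-tree rule).  Cell `lit-balaban`, P6 CARVING FAN block 28 (`carve/BLOCKS-21-30.md` § Block 28,
lead g30 READY 05:30Z; rules `carve/CARVE-RULES.md`; claimed by seat carve-08 g4 under RULING #8, `carve/STATUS.md`
07:57Z, referee of record check-3): [B13] pp. 8–11.  KEY item (consumer) `stmt-QuantumFields-20543` (K2⁷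
`EndpointGivenBR13SepCoPH`; DAG node [B13] = the leaf `B13.Lemma1Printed ∧ Lemma2Printed ∧ Lemma3Printed` of
`DagBinding.Upstream.ofPrinted`); also-feeds 20544, 20542.  Neighbours: block 27 (pp. 1–7, (1.1)–(1.25)) and block 29
(pp. 11–17, `B13Carve29Sect2ClusterHyp`, landed); Lemma 3 ∕ pp. 18–22 = block 30 (`B13Carve30Lemma3MainHyp`, landed).

IN TREE = CITED, NEVER RESTATED.  All 17 SKELETON rows of the block have a declaration of record (row → decls):
**B13.Lem1** Lemma 1 (1.33)–(1.36) p. 9: `B13.Lemma1Printed` ∕ `B13.Bound136` ∕ the space (1.34) `B13Space134.space134` ∕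
`B13.StepData.sp1`; ASSEMBLED from the located inputs of pp. 7–9 by `B13Lemma1Assembly.lemma1Printed_of_sect1` ∕
`lemma1Printed_of_129` ∕ `bound136_of_129` ∕ `bound129_of_levels` and, for the (I.3.7)-half, `B13Lemma1Eq130.boundP9_of_130`
∕ `gather_p9`; PROVED outright on the papers' periodic carrier by `B13Lemma1Torus` ∕ `B13Lemma1DepTorus` ∕
`B13Lemma1BlocksTorus` ∕ `B13Lemma1TorusTower` (with `B13CubeSumTorus`, `B13Lemma1BlocksTorusNonvacuity`).  **B13.Lem2**
Lemma 2 (1.41)–(1.43) p. 11: `B13.Lemma2Printed` ∕ `B13.Repr142` ∕ `B13.Bound143` ∕ `B13.StepData.quadForm` ∕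
`B13.lemma2_of_lemma1` ∕ `B13Bound143.bound143_of_oneShot` ∕ `norm_Qsum_le_oneShot` (module `B13Bound143OneShot`, with the
restriction `B13Bound143.R12` p. 16 and the unprinted `R25`, `R26`) ∕ `B13Lemma2LeadingParts` ∕ `Node00.W1.TermDatum214.Lemma2Inputs`.  **B13.Eq1.26** (1.26)
p. 8 *«Σ_{X∈𝐃_j, X⊃□′} exp(−κd_j(X)) ≦ O(1) (1.26) for κ sufficiently large. The number O(1) is in fact small, because
we sum over X with d_j(X) ≠ 0»*: PROVED `TreeLengthCubeSystem.ineq126_treeLen`; statement-level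
`B12TreeDecay.CubeSystem.Ineq126Printed` ∕ `B13FamilySum.Ineq126` ∕ `B12Ext436.DomainClass.Ineq126`.  **B13.Eq1.27**
(1.27) p. 8 (*«… ≦ e (1.27) for κ₁ sufficiently large»*, threshold explicit): `B13Sect1Statements.Eq127` ∕ `Eq127_holds` ∕
`B13Sect1Arith.bound_127` ∕ `threshold_127` ∕ `B13Lemma1Assembly.sumY0_127`.  **B13.Eq1.28** (1.28) p. 8:
`B13Sect1Statements.Eq128` (typed AS PRINTED, FOR THE RECORD: its first inequality is the lower half of (2.30) and fails
on degenerate domains, cell GAPS G-B13-07) ∕ `eq128_of_lower230` ∕ `B13Sect1Arith.bound_128_printed` ∕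
`bound_128_repaired` ∕ on the torus `B13Lemma1Torus.outer128_torus`.  **B13.Eq1.29** (1.29) p. 8: the exponent
bookkeeping `B13Sect1Arith.exponent_129`, the resummation `gather_129`, the function-level form
`B13Lemma1Assembly.bound129_of_levels`; *«the sum over j is bounded by 2(6L)⁴»* `B13Sect1Arith.jsum_le` ∕
`B13Lemma1Eq130.jsum_le_two`.  **B13.Eq1.30** (1.30) pp. 8–9 and **B13.Eq1.32** (1.32) p. 9: `B13Sect1Arith.bound_132`
((1.31) ⇒ (1.32) under R8) ∕ `factor_Ljη` (*«The first term under the exponential gives also the factor L^jη»*) ∕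
`B13Lemma1Eq130.boundP9_of_130` ((1.30) verbatim as its hypothesis `h130`) ∕ the □′-sum of p. 9 PROVED on the torus
`B13CubeSumTorus.cubeSum_p9` ∕ `cubeSum_p9_hq`.  **B13.Eq1.31** (1.31) *«the fundamental scaling inequality»* p. 9: PROVED
`TreeLength.mul_treeLen_closureIdx_le`.  The p. 7 ∕ p. 9 ll. 9–12 common-domain sentences (*«each term is defined and
analytic on the corresponding space (I.3.16) restricted to the domain Y. All these spaces contain the subspace
U^c_{k+1}(Y, (1+β)α₀, (1+β)α₁, α₀), and all the terms are defined and analytic on it»*):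
`B13Sect1Statements.OnDomain7` ∕ `CommonDomain7` ∕ `commonDomain7_of_onDomain` (generic in the term family: the p. 9
sentence is its instance at the (I.3.7)-type terms).  p. 9, R9 ⇒ the rate of (1.36): `B13Sect1Arith.rate_R9` ∕
`shape_136`; the p. 9 cube chain's arithmetic `B13Sect1Arith.cubesum_p9` ∕ `lin_le_exp`.  **B13.Eq1.37** (1.37) p. 10:
`B13HaarSigma.phi` (the decomposition of unity, `V_□`).  **B13.Eq1.38** (1.38) p. 10: `B13ExpansionOrder.slice`; *«The
terms of zeroth and first order vanish»* `B13ExpansionOrder.beginsAt_two`; *«the second order term is written as a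
quadratic form with coefficients given by second order derivatives of the function (1.38)»* `B13ExpansionOrder.homPart_two_eq`
∕ `B13Ineq140.coeff140` ∕ `d2`.  **B13.Eq1.39** (1.39) p. 10 (*«where C₃ is an absolute constant»* = `B13.Consts.C₃`):
`B13Ineq140.Ineq139` ∕ `rad` (*«{B′ : e^{16κ₁}|B′| ≦ a₁ on Y}»*) ∕ `cubic_of_139`.  **B13.Eq1.40** (1.40) p. 10:
`B13Ineq140.Ineq140Printed` ∕ `norm_d2_le_of_cubic_pos` ∕ `ineq140_sharp` ∕ `absorb140` (absorption hypothesis R10) ∕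
`ineq140Printed_of_139` ∕ *«if e^{16κ₁}|B′| ≦ ⅓a₁»* `three_norm_le_rad` ∕ *«Taking B′ as in (1.19) we obtain the above
bound with |B′| replaced by C₁ε₁»* `ineq140_C₁ε₁` (with (1.19)–(1.20) `B13Sect1Statements.Bprime119` ∕
`norm_Bprime119_le_C₁`); p. 11 ll. 2–5 *«we sum over all admissible □ ⊂ Y. This yields an expression satisfying the bounds
(1.39), (1.40) with the additional factor M⁻⁴|Y| ≦ exp M⁻⁴|Y|»* PROVED `B13Ineq140.norm_sum_le_exp_card_mul`.
**B13.Eq1.41**, **B13.Eq1.42**, **B13.Eq1.43** (1.41)–(1.43) p. 11: `B13.Lemma2Printed` ∕ `B13.StepData.quadForm` ∕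
`B13.Repr142` ∕ `B13.Bound143`.  **B13.G1** the geometric input behind (1.25)∕(1.32): PROVED `TreeLength.adjoinLeaf_treeLen`
(on the torus `B13Lemma1Torus.g1_torus`).  Also IN TREE and cited: the constants `B13.Consts` (restrictions of record
`B13.Consts.R15`, `R16`, `R21`–`R24`, `B13Bound143.R12` ∕ `R25` ∕ `R26`, `B13.Consts.delta_bounds_of_R22`), the carrier `B13.StepData`, the
record `Node00.…DagBinding.PrintedCarriersR.withB13OfRecord`, and the slot probes `B13ResidualSlotProbe` ∕
`B13ResidualSlotProbe9` ∕ `B13ResidualLeafProbe` (kernel witnesses about the leaf, not statements of print).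

WHAT THIS FILE DECLARES (hypothesis-form `Prop`s with the verbatim sentence and locator; kernel-checked bookkeeping; NOTHING
of the paper is asserted, no printed bound is proved here except where marked PROVED).
* §1 the residual printed statements of pp. 8–10 that had NO declaration of record — each existed at most as a
  hypothesis BINDER of the tree's assembly theorems (named at each slot): p. 8 ll. 12–13 the count *«This yields
  (6L)⁴L^jη»* (`CubeCountP8Printed`; binder `hq`); **(1.29)** p. 8 in its printed shape `E₀ε₁O(M^q)exp O(1)κ₁
  exp(−(1∕16)κ₁d_k(Y))` (`Bound129Printed`; binder `h129`, which collapses the prefactor to a letter); p. 9 l. 8 the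
  proviso of (1.32) *«if ¼(κ₁ − 1) ≧ (1 − δ)κ, 0 < δ < 1»* (`Restr132Printed`; binders `hR8`, `hδ1`; census R8); p. 9
  ll. 17–19 the cube chain *«M⁻⁴|Y| ≦ 3·2³d_k(Y) ≦ exp δκd_k(Y)»* AS PRINTED, for the record exactly like its (1.28)
  twin `B13Sect1Statements.Eq128` (`CubeChainP9Printed`, with the conditional proof `cubeChainP9_of_lower230`), and
  the sentence's bound on the count of the □-sum (`CubeSumP9Printed`; binder `hc`); p. 9 ll. 20–21 *«again a bound of
  the form (1.29) … with the last exponential replaced by exp(−(1 − 2δ)κd_k(Y))»* (`Bound129pPrinted`; binder `h129′`);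
  p. 9 ll. 21–22 *«We assume that (1∕16)κ₁ ≧ (1 − 2δ)κ»* (`Restr136Printed`; binder `hR9`; census R9); p. 10 ll. 30–31
  the analyticity of (1.38) in `B′` on the polydisc (`Analytic138Printed`; binder `hF`).
* §2 the carriers `Carriers S E F` (DATA) and the bundle `Hyp S c X` = the conjunction BY NAME of the block's printed
  statements: Lemma 1 `B13.Lemma1Printed`, Lemma 2 `B13.Lemma2Printed`, (1.27) `B13Sect1Statements.Eq127`, (1.39)
  `B13Ineq140.Ineq139` and (1.40) `B13Ineq140.Ineq140Printed` for every term (1.38), and the §1 slots — so that a node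
  prover takes `(h : Hyp S c X)`.
* §3 bookkeeping PROVED by name: the projections a consumer cites, and knits showing that the §1 slots ARE the located
  inputs of the tree's theorems (`bound136_of_129`, `bound_132`, `rate_R9`, `cubesum_p9`, `delta_bounds_of_R22`,
  `ineq140_sharp`, `ineq140Printed_of_139`).
* §4 (v1.1, answering check-3 g2 M-c3-3; append-only — every v1 declaration above is unchanged): the USED form of the
  p. 9 □-count bound `CubeSumP9UsedPrinted` (domains with `1 ≦ d_k(Y)`); the refutation of the v1 record conjunct on the
  tree's own carriers (`not_cubeSumP9Printed_of_degenerate`, `not_cubeSumP9Printed_sys`, `not_hyp_of_degenerate`); the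
  MODEL of the used form on the tree's own carriers (`cubeSumP9Used_sys`, δκ ≧ log(8·2^d)); the corrected bundle `Hyp1`
  (eleven conjuncts of `Hyp` by the same names + `cube9` in the used form), `Hyp.toHyp1`, and `Hyp1`'s bookkeeping
  (the projections and knits of §3 re-keyed, and `Hyp1.hc` ∕ `Hyp1.hc_all` for `B13Lemma1Eq130.boundP9_of_130`).
NOT CONJOINED INTO `Hyp` (and why): (1.28) `B13Sect1Statements.Eq128` and its p. 9 twin `CubeChainP9Printed` — records AS
PRINTED whose first inequality fails on degenerate domains (G-B13-07); a bundle containing them would be unsatisfiable on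
the tree's own carriers (`TreeLength.treeLen_singleton`).  **v1.1 CORRECTION (check-3 g2 M-c3-3, `carve/CHECK-3.md`
§ SECOND READ PART 1, 2026-08-28).**  v1 conjoined instead the outer inequality of the p. 9 sentence over EVERY domain,
`CubeSumP9Printed S.Dk S.volk` (conjunct `Hyp.cube9`), believing it to be the harmless USED consequence; it is NOT: at a
degenerate domain with two cubes (two cubes with a common wall ARE a localization domain, [Balaban1987RG1] p. 257, with
d_k = 0 — `B13Ineq230Printed.pair` ∕ `dj_pair` ∕ `count_pair`) it demands `2 ≦ e⁰ = 1`, so `CubeSumP9Printed (sys B)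
(count B) δ κ` is FALSE for every δ, κ (`not_cubeSumP9Printed_sys`, §4) and the v1 bundle `Hyp S c X` is UNSATISFIABLE for
every `S` whose `(Dk, volk)` are Bałaban's (𝐃_k, M⁻⁴|·|) on a window with two adjacent cubes (`not_hyp_of_degenerate`,
§4).  Print does not share the defect as a hypothesis: the p. 9 display is a proof step used only in the construction's
regime *«we sum over X with d_j(X) ≠ 0, as it follows from our inductive construction»* (p. 8 ll. 7–8), i.e. d_k(Y) ≧ 1
(d_k is a tree length formed by cube edges).  v1.1 therefore KEEPS every v1 declaration (append-only; `Hyp` v1 stays as a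
RECORD, refuted on faithful carriers) and ADDS §4: the USED form `CubeSumP9UsedPrinted` (*«≦ exp δκd_k(Y)»* for the
domains with `1 ≦ d_k(Y)`), PROVED to hold on the tree's own carriers once `δκ ≧ log(8·2^d)` (`cubeSumP9Used_sys`, from
`B13Ineq230Printed.count_le_exp_sys`), and the corrected bundle `Hyp1` (= `Hyp` with `cube9` in the used form) with its
bookkeeping, among which `Hyp1.hc` delivers the binder `hc` of `B13Lemma1Eq130.boundP9_of_130` for every cube family
that is empty or a single cube at the degenerate domains (print's empty sums there).  CONSUMERS (KEY
`stmt-QuantumFields-20543`): take `(h : Hyp1 S c X)`, not `Hyp`.  The records stay citable; (1.26), (1.31), G1, p. 11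
ll. 2–5 — PROVED theorems (nothing to assume); the object-level sentences of p. 10 ll. 12–15 ∕ 29–33 on the whole-lattice
space *«U^c_{k+1}(T_η, α′₀, α′₁)»*, *«localized in the interior of Y»* and *«analytic in σ(Y) on the polydisc |σ(Y)| ≦
e^{κ₁}»* — carriers ((𝐔, 𝐉)-spaces on T_η, the Haar variables σ of `B13HaarSigma`) the K2⁷ consumer does not hold; NOT
TYPED, cited here by locator only.  HONEST SCOPE: with carriers chosen freely every conjunct is inhabited by trivial data
(zero functions, empty index types); the bundle earns its keep only when `S`, `X` are read off Bałaban's objects.  Rung (B)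
context only.  No `sorry`, no axiom, no instance, no notation.
-/

namespace Literature.MathematicalPhysics.QuantumFieldTheory.Balaban1983to89.B13Carve28Lemmas1to2Hyp

open Literature.MathematicalPhysics.QuantumFieldTheory.Balaban1983to89

noncomputable section

/-! ## §1 Residual printed statements of pp. 8–10 (no declaration of record before this file) -/

/-- **p. 8 [PDF 8] ll. 12–13, the cube count of the first X-sum**, verbatim: *«To bound the first sum, over □′ ⊂ □̃², we
use the factor (L^jη)⁵ in (1.24). This yields (6L)⁴L^jη, and the sum over j is bounded by 2(6L)⁴.»* — the first two
sentences as the located count they are used as: for the finite family `Sq` of the cubes □′ ∈ π_j with □′ ⊂ □̃² and the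
scaled length `ℓ` = `L^jη` of that scale, `#Sq·(L^jη)⁵ ≦ (6L)⁴·L^jη`.  The binder `hq` of
`B13Lemma1Assembly.lemma1Printed_of_sect1` (there with `ℓ = L^j(L^k)⁻¹`); PROVED on the periodic carrier by
`B13BlockGeometryTorus.count_6L` (used in `B13Lemma1BlocksTorus`).  (The j-sum *«bounded by 2(6L)⁴»* is PROVED: `B13Sect1Arith.jsum_le`.)
[cite: Balaban1988RG2Cluster, p.8 (after (1.26))] -/
def CubeCountP8Printed {γ : Type*} (Sq : Finset γ) (L ℓ : ℝ) : Prop :=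
  (Sq.card : ℝ) * ℓ ^ 5 ≤ (6 * L) ^ 4 * ℓ

/-- **(1.29)** p. 8 [PDF 8] ll. 20–22, verbatim: *«Gathering together the above bounds we obtain
|Σ(1.23)| ≦ E₀ε₁O(M^q) exp O(1)κ₁ exp(−(1∕16)κ₁d_k(Y)), (1.29) with absolute constants O(1), q. The constant q is a small,
nonnegative integer, which can be easily calculated from the conditions on α₁, α₂, α₃.»* — for the Y-sum `W Y` of the
terms (1.23) with localization domain `Y`, as a function on the space (1.34) (`S.sp1 Y`), with the two printed `O(1)`'s
explicit: `A` in `O(M^q) = A·M^q` and `A′` in `exp O(1)κ₁ = exp A′κ₁` (`q` = `c.q : ℕ`).  By p. 8 ll. 26–34 and p. 9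
ll. 23–25 the same bound is printed for the remaining terms of (I.3.34) and for the expression (I.3.21).  The tree carried
(1.29) only as the binder `h129` of `B13Lemma1Assembly.bound136_of_129` (prefactor collapsed to a letter `P₁`) and as the
conclusion of `bound129_of_levels`; its exponent bookkeeping is `B13Sect1Arith.exponent_129`. [cite: Balaban1988RG2Cluster, (1.29) p.8] -/
def Bound129Printed (S : B13.StepData) (c : B13.Consts) (W : S.Dk.Dom → S.Φ → ℂ) (A A' : ℝ) : Prop :=
  ∀ Y φ, φ ∈ S.sp1 Y →
    ‖W Y φ‖ ≤ c.E₀ * c.ε₁ * (A * c.M ^ c.q) * Real.exp (A' * c.κ₁) * Real.exp (-(1 / 16) * c.κ₁ * S.Dk.dj Y)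

/-- **p. 9 [PDF 9] ll. 20–21, the (I.3.7)-type half**, verbatim: *«These estimates yield again a bound of the form (1.29) for
the considered sum, with the last exponential replaced by exp(−(1 − 2δ)κd_k(Y)).»* — for the Y-sum `W Y` of the terms
bounded through (1.30)–(1.32), on the space (1.34), with the printed prefactor shape of (1.29) (`A`, `A′` as in
`Bound129Printed`).  The tree carried this as the binder `h129′` of `B13Lemma1Assembly.bound136_of_129` (prefactor a letter
`P₂`) and as the conclusion of `B13Lemma1Eq130.boundP9_of_130`. [cite: Balaban1988RG2Cluster, p.9 (after (1.32))] -/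
def Bound129pPrinted (S : B13.StepData) (c : B13.Consts) (W : S.Dk.Dom → S.Φ → ℂ) (A A' : ℝ) : Prop :=
  ∀ Y φ, φ ∈ S.sp1 Y →
    ‖W Y φ‖ ≤ c.E₀ * c.ε₁ * (A * c.M ^ c.q) * Real.exp (A' * c.κ₁) * Real.exp (-(1 - 2 * c.δ) * c.κ * S.Dk.dj Y)

/-- **p. 9 [PDF 9] ll. 6–8, the proviso of (1.32)**, verbatim: *«It implies that the last two exponentials in (1.30) can be
bounded by exp(−(1 − δ)κd_k(Y) − δκd_j(X)), (1.32) if ¼(κ₁ − 1) ≧ (1 − δ)κ, 0 < δ < 1.»* — the restriction on the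
constants (cell census R8; the binder `hR8` of `B13Sect1Arith.bound_132` ∕ `B13Lemma1Eq130.boundP9_of_130`) with the
printed range of `δ` (their binder `hδ1`). [cite: Balaban1988RG2Cluster, (1.32) p.9] -/
def Restr132Printed (c : B13.Consts) : Prop :=
  (1 - c.δ) * c.κ ≤ (1 / 4) * (c.κ₁ - 1) ∧ 0 < c.δ ∧ c.δ < 1

/-- **p. 9 [PDF 9] ll. 21–22, the restriction behind the rate of (1.36)**, verbatim: *«We assume that (1∕16)κ₁ ≧ (1 − 2δ)κ,
hence we can bound both sums by the above exponential.»* — cell census R9; the binder `hR9` of `B13Sect1Arith.rate_R9` ∕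
`shape_136` ∕ `B13Lemma1Assembly.bound136_of_129` ∕ `lemma1Printed_of_sect1`. [cite: Balaban1988RG2Cluster, p.9 (before Lemma 1)] -/
def Restr136Printed (c : B13.Consts) : Prop :=
  (1 - 2 * c.δ) * c.κ ≤ (1 / 16) * c.κ₁

/-- **p. 9 [PDF 9] ll. 17–19, the cube chain AS PRINTED (record)**, verbatim: *«Finally, the sum over all possible cubes □
can be bounded by M⁻⁴|Y| ≦ 3·2³d_k(Y) ≦ exp δκd_k(Y).»* — typed exactly like its (1.28) twin `B13Sect1Statements.Eq128`
(there with the rate `(1∕16)(κ₁ − 2)`, here `δκ`): over the system `D` of localization domains 𝐃_k (tree length `D.dj` =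
d_k) and the cube count `vol Y` = M⁻⁴|Y|, both inequalities for every Y.  RECORD ONLY, same caveat as `Eq128`: the first
`≦` is the lower half of (2.30) p. 18 (`B13Ineq230Printed.Ineq230Lower`) and fails for degenerate domains (d_k(Y) = 0,
|Y| ≧ 1 — cell GAPS G-B13-07, `TreeLength.treeLen_singleton`); the second `≦` carries no printed proviso and holds for
d_k(Y) ≧ 1 once `δκ ≧ log 24` (`B13Sect1Arith.cubesum_p9`; the printed *«δκ sufficiently large»* of l. 15 qualifies
the use of (1.26) two sentences earlier).  The conditional form is PROVED below (`cubeChainP9_of_lower230`); the bundle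
carries the consequence print uses (`CubeSumP9Printed`). [cite: Balaban1988RG2Cluster, p.9 (after (1.32))] -/
def CubeChainP9Printed (D : LocDomainSys) (vol : D.Dom → ℕ) (δ κ : ℝ) : Prop :=
  ∀ Y : D.Dom, (vol Y : ℝ) ≤ 3 * 2 ^ 3 * D.dj Y ∧ 3 * 2 ^ 3 * D.dj Y ≤ Real.exp (δ * κ * D.dj Y)

/-- **p. 9 [PDF 9] ll. 17–19, what the sentence bounds**: *«the sum over all possible cubes □ can be bounded by M⁻⁴|Y| ≦
… ≦ exp δκd_k(Y)»* — the number `cnt Y` of terms of the □-sum for the localization domain `Y` (at most the cube count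
M⁻⁴|Y|) is `≦ exp δκd_k(Y)`: EXACTLY the located input `hc` of `B13Lemma1Eq130.boundP9_of_130` (there `cnt Y = #(Sc Y)`,
the admissible cubes □ ⊂ Y), the factor that turns the rate `(1 − δ)κ` of (1.32) into the `(1 − 2δ)κ` of (1.36).
**RECORD ONLY (v1.1, check-3 g2 M-c3-3):** quantified over EVERY domain this inherits the degenerate-domain slip of the
chain's first member — at a two-cube domain (d_k = 0, two cubes) it reads `2 ≦ 1`; FALSE on the tree's own carriers
(`not_cubeSumP9Printed_of_degenerate`, `not_cubeSumP9Printed_sys`, §4).  The form print USES (domains with d_k(Y) ≧ 1,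
p. 8 ll. 7–8) is `CubeSumP9UsedPrinted` (§4), which this record implies (`CubeSumP9Printed.used`).
[cite: Balaban1988RG2Cluster, p.9 (after (1.32))] -/
def CubeSumP9Printed (D : LocDomainSys) (cnt : D.Dom → ℕ) (δ κ : ℝ) : Prop :=
  ∀ Y : D.Dom, (cnt Y : ℝ) ≤ Real.exp (δ * κ * D.dj Y)

/-- The printed chain implies the bound on the count (transitivity). [cite: Balaban1988RG2Cluster, p.9 (after (1.32))] -/
theorem CubeChainP9Printed.cubeSum {D : LocDomainSys} {vol : D.Dom → ℕ} {δ κ : ℝ} (h : CubeChainP9Printed D vol δ κ) :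
    CubeSumP9Printed D vol δ κ :=
  fun Y => (h Y).1.trans (h Y).2

/-- A □-sum with at most `vol Y` terms inherits the bound (*«the sum over all possible cubes □ can be bounded by M⁻⁴|Y|»*:
the admissible cubes □ ⊂ Y are among the M⁻⁴|Y| cubes of Y). [cite: Balaban1988RG2Cluster, p.9 (after (1.32))] -/
theorem CubeSumP9Printed.of_count_le {D : LocDomainSys} {vol cnt : D.Dom → ℕ} {δ κ : ℝ}
    (h : CubeSumP9Printed D vol δ κ) (hle : ∀ Y, cnt Y ≤ vol Y) : CubeSumP9Printed D cnt δ κ :=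
  fun Y => le_trans (by exact_mod_cast hle Y) (h Y)

/-- The chain in the regime where print uses it — the exact analogue of `B13Sect1Statements.eq128_of_lower230`: if every
domain has d_k(Y) ≧ 1 and satisfies the volume bound M⁻⁴|Y| ≦ 3·2³d_k(Y) (the lower half of (2.30), an INPUT here), then
for `δκ ≧ log 24` both printed inequalities hold (`B13Sect1Arith.cubesum_p9`). PROVED. [cite: Balaban1988RG2Cluster, p.9 (after (1.32))] -/
theorem cubeChainP9_of_lower230 (D : LocDomainSys) (vol : D.Dom → ℕ) {δ κ : ℝ}
    (hvol : ∀ Y, (vol Y : ℝ) ≤ 24 * D.dj Y) (hd : ∀ Y, 1 ≤ D.dj Y) (hδκ : Real.log 24 ≤ δ * κ) :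
    CubeChainP9Printed D vol δ κ := by
  intro Y
  have h := B13Sect1Arith.cubesum_p9 (hvol Y) (hd Y) hδκ
  have h24 : (3 : ℝ) * 2 ^ 3 = 24 := by norm_num
  refine ⟨?_, ?_⟩
  · rw [h24]; exact hvol Y
  · rw [h24]; exact h.1

/-- **p. 10 [PDF 10] ll. 29–31, analyticity of the term (1.38) in the fluctuation variable**, verbatim: *«The above
expression is localized in the interior of Y, with respect to 𝐔, 𝐉, B_k or B. It is an analytic function of (𝐔, 𝐉) in the
space U^c_{k+1}(T_η, α′₀, α′₁), and of B′ in the domain {B′ : e^{16κ₁}|B′| < a₁ on Y}, as it follows from the considerations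
of the beginning of the section.»* — typed: the `B′`-clause, for the term (1.38) `Fk` at fixed (𝐔, 𝐉) as a map of complex
normed spaces, on the open polydisc `‖B′‖ < a₁e^{−16κ₁}` = `ball 0 (B13Ineq140.rad κ₁ a₁)` (the reading of record of
`B13Ineq140`, module docstring: *«analytic … of B′ in the domain»* = `AnalyticOnNhd ℂ Fk (ball 0 (rad κ₁ a₁))`); the binder
`hF` of `B13Ineq140.ineq140_sharp` ∕ `ineq140Printed_of_139` ∕ `B13Bound143.norm_Qsum_le_oneShot`.  (The (𝐔, 𝐉)-
clause and the locality clause are object-level — see the module docstring, NOT TYPED.) [cite: Balaban1988RG2Cluster, p.10 (after (1.38))] -/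
def Analytic138Printed {E F : Type*} [NormedAddCommGroup E] [NormedSpace ℂ E] [NormedAddCommGroup F] [NormedSpace ℂ F]
    (Fk : E → F) (κ₁ a₁ : ℝ) : Prop :=
  AnalyticOnNhd ℂ Fk (Metric.ball 0 (B13Ineq140.rad κ₁ a₁))

/-! ## §2 The carriers and the bundle -/

/-- **THE CARRIERS OF THE BLOCK'S STATEMENTS BEYOND `B13.StepData`** (DATA, no claim): the two Y-sums into which print
splits `V′_k(Y, ·)` — `W₁ Y` = the Y-sum of the (1.23)-type terms (the last term of (I.3.34) pp. 7–8, the remaining terms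
of (I.3.34) p. 8 ll. 26–34, the expression (I.3.21) p. 9 ll. 23–25), bounded in the form (1.29), and `W₂ Y` = the Y-sum
of the (I.3.7)-type terms bounded through (1.30)–(1.32) (p. 8 l. 35 – p. 9 l. 22) — with the printed absolute constants of
their (1.29)-form bounds (`A`, `A′`; `A₂`, `A₂′`); the number `k` of scales and, for `j ≦ k` and a domain `Y`, the finite
family `Sq Y j` of the cubes □′ ⊂ □̃² of π_j of p. 8 (index type `γ`); and, for p. 10, the index type `T` of the pairs
(□, Y), □ ⊂ Y ∈ 𝐃_k admissible (with `Ydom t` the domain Y and `nYc t` = M⁻⁴|Y∖□|), the radius letter `a₁` of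
[Balaban1985Averaging], and the term (1.38) `Fk t` as a function of `B′` between the complex normed spaces `E` (fields
`B′` on Y) and `F` (values; `ℂ` in print).  TOTALITY NOTE: total data, junk-satisfiable in isolation; nothing claimed.
[cite: Balaban1988RG2Cluster, (1.29) p.8, (1.38)–(1.40) p.10 (the objects named there)] -/
structure Carriers (S : B13.StepData) (E F : Type*) where
  (W₁ W₂ : S.Dk.Dom → S.Φ → ℂ)
  (A A' A₂ A₂' : ℝ)
  k : ℕ
  γ : Type
  Sq : S.Dk.Dom → ℕ → Finset γ
  T : Type
  Ydom : T → S.Dk.Dom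
  nYc : T → ℝ
  a₁ : ℝ
  Fk : T → E → F

/-- **[Balaban1988RG2Cluster] pp. 8–11 AS ONE HYPOTHESIS** (the bundle of CARVE-RULES §2.5) for step data `S`, constants `c`
and carriers `X`: Lemma 1 p. 9 (`B13.Lemma1Printed`: analyticity on (1.34) ∧ (1.36)); Lemma 2 p. 11 (`B13.Lemma2Printed`:
analyticity ∧ (1.42) ∧ (1.43) ∧ (1.36) for V″_k ∧ gauge invariance); (1.27) p. 8 (`B13Sect1Statements.Eq127`, a closed
`Prop`, PROVED in the tree by `Eq127_holds` — conjoined by name, dischargeable); the p. 8 cube count for every `Y` and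
`j ≦ k` (`CubeCountP8Printed`, in the exact binder shape `hq` of `B13Lemma1Assembly.lemma1Printed_of_sect1`); (1.29) p. 8
for `W₁` (`Bound129Printed`) and its p. 9 twin for `W₂` (`Bound129pPrinted`); the p. 9 provisos (`Restr132Printed`,
`Restr136Printed`); the p. 9 bound on the □-sum's count, at the cube count M⁻⁴|Y| (`CubeSumP9Printed S.Dk S.volk`); for every
term (1.38): its analyticity in `B′` p. 10 (`Analytic138Printed`), (1.39) (`B13Ineq140.Ineq139`) and (1.40)
(`B13Ineq140.Ineq140Printed`, with `d_k(Y)` and `M⁻⁴|Y|` read off `S`).  A `structure … : Prop`, one named field per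
statement; consumed as `(h : Hyp S c X)`; never proved here, never asserted.  (1.28) and the p. 9 chain record are
deliberately NOT conjuncts (see the module docstring).  **SUPERSEDED (v1.1, check-3 g2 M-c3-3): the conjunct `cube9` over
EVERY domain makes this v1 bundle UNSATISFIABLE on the tree's own carriers (`not_hyp_of_degenerate`, §4); it stays as a
RECORD (append-only re-file); consumers take the corrected bundle `Hyp1` (§4), which this one implies (`Hyp.toHyp1`).**
[cite: Balaban1988RG2Cluster, Lemma 1 p.9, Lemma 2 p.11, (1.27)–(1.40) pp.8–10] -/
structure Hyp (S : B13.StepData) (c : B13.Consts) {E F : Type*} [NormedAddCommGroup E] [NormedSpace ℂ E]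
    [NormedAddCommGroup F] [NormedSpace ℂ F] (X : Carriers S E F) : Prop where
  /-- Lemma 1 (1.33)–(1.36) p. 9 -/
  lem1 : B13.Lemma1Printed S c
  /-- Lemma 2 (1.41)–(1.43) p. 11 -/
  lem2 : B13.Lemma2Printed S c
  /-- (1.27) p. 8 -/
  eq127 : B13Sect1Statements.Eq127
  /-- p. 8: `#{□′ ∈ π_j : □′ ⊂ □̃²}·(L^jη)⁵ ≦ (6L)⁴L^jη`, `L^jη = L^j(L^k)⁻¹`, for every `Y` and `j ≦ k` -/
  count8 : ∀ Y, ∀ j ∈ Finset.range (X.k + 1),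
    CubeCountP8Printed (X.Sq Y j) (c.L : ℝ) ((c.L : ℝ) ^ j * ((c.L : ℝ) ^ X.k)⁻¹)
  /-- (1.29) p. 8 for the Y-sum of the (1.23)-type terms -/
  b129 : Bound129Printed S c X.W₁ X.A X.A'
  /-- p. 9: the same shape with the rate `(1 − 2δ)κ` for the (I.3.7)-type Y-sum -/
  b129p : Bound129pPrinted S c X.W₂ X.A₂ X.A₂'
  /-- p. 9: `¼(κ₁ − 1) ≧ (1 − δ)κ`, `0 < δ < 1` -/
  r132 : Restr132Printed c
  /-- p. 9: `(1∕16)κ₁ ≧ (1 − 2δ)κ` -/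
  r136 : Restr136Printed c
  /-- p. 9: the □-sum over `Y` has `≦ exp δκd_k(Y)` terms (at the cube count M⁻⁴|Y|) — v1 RECORD conjunct over EVERY
  domain; FALSE at a two-cube domain (d_k = 0) on the tree's own carriers (v1.1, M-c3-3): see `Hyp1.cube9` -/
  cube9 : CubeSumP9Printed S.Dk S.volk c.δ c.κ
  /-- p. 10: every term (1.38) is analytic in `B′` on the polydisc `e^{16κ₁}|B′| < a₁` -/
  an138 : ∀ t : X.T, Analytic138Printed (X.Fk t) c.κ₁ X.a₁
  /-- (1.39) p. 10, for every term (1.38) -/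
  i139 : ∀ t : X.T, B13Ineq140.Ineq139 (X.Fk t) c.κ₁ X.a₁ c.C₃ c.M (X.nYc t)
  /-- (1.40) p. 10, for every term (1.38) -/
  i140 : ∀ t : X.T, B13Ineq140.Ineq140Printed (X.Fk t) c.κ₁ X.a₁ c.C₃ (S.Dk.dj (X.Ydom t)) (S.volk (X.Ydom t) : ℝ)

/-! ## §3 Bookkeeping a consumer cites (PROVED; projections and the tree's theorems by name) -/

section Bookkeeping

open Metric

variable {S : B13.StepData} {c : B13.Consts} {E F : Type*} [NormedAddCommGroup E] [NormedSpace ℂ E]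
  [NormedAddCommGroup F] [NormedSpace ℂ F] {X : Carriers S E F}

/-- Under `Hyp`: the analyticity clause of Lemma 1 (V′_k(Y) analytic on (1.34)). [cite: Balaban1988RG2Cluster, Lemma 1 p.9] -/
theorem Hyp.analytic_Vp (h : Hyp S c X) (Y : S.Dk.Dom) : S.Analytic (S.Vp Y) (S.sp1 Y) :=
  h.lem1.1 Y

/-- Under `Hyp`: the bound (1.36) for `V′_k` — a projection of Lemma 1. [cite: Balaban1988RG2Cluster, (1.36) p.9] -/
theorem Hyp.bound136_Vp (h : Hyp S c X) : B13.Bound136 S c S.Vp :=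
  h.lem1.2

/-- Under `Hyp`: the representation (1.42) — a projection of Lemma 2. [cite: Balaban1988RG2Cluster, (1.42) p.11] -/
theorem Hyp.repr142 (h : Hyp S c X) : B13.Repr142 S :=
  h.lem2.2.1

/-- Under `Hyp`: the bound (1.43) on the matrix elements of the quadratic form — a projection of Lemma 2.
[cite: Balaban1988RG2Cluster, (1.43) p.11] -/
theorem Hyp.bound143 (h : Hyp S c X) : B13.Bound143 S c :=
  h.lem2.2.2.1

/-- Under `Hyp`: (1.36) for `V″_k` — a projection of Lemma 2. [cite: Balaban1988RG2Cluster, Lemma 2 p.11] -/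
theorem Hyp.bound136_Vpp (h : Hyp S c X) : B13.Bound136 S c S.Vpp :=
  h.lem2.2.2.2.1

/-- Under `Hyp`: the gauge-invariance clause of Lemma 2 for `V_k(Y)`, the quadratic form and `V″_k(Y)`.
[cite: Balaban1988RG2Cluster, Lemma 2 p.11] -/
theorem Hyp.gaugeInv (h : Hyp S c X) (Y : S.Dk.Dom) :
    S.GaugeInv (S.V Y) ∧ S.GaugeInv (S.quadForm Y) ∧ S.GaugeInv (S.Vpp Y) :=
  h.lem2.2.2.2.2 Y

/-- KNIT p. 8: the conjunct `count8` IS, definitionally, the located input `hq` of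
`B13Lemma1Assembly.lemma1Printed_of_sect1` (displayed here in that theorem's own spelling). PROVED (`Iff.rfl`-level).
[cite: Balaban1988RG2Cluster, p.8 (after (1.26))] -/
theorem Hyp.hq (h : Hyp S c X) :
    ∀ Y, ∀ j ∈ Finset.range (X.k + 1),
      ((X.Sq Y j).card : ℝ) * ((c.L : ℝ) ^ j * ((c.L : ℝ) ^ X.k)⁻¹) ^ 5 ≤
        (6 * (c.L : ℝ)) ^ 4 * ((c.L : ℝ) ^ j * ((c.L : ℝ) ^ X.k)⁻¹) :=
  h.count8

/-- KNIT p. 9 ⇒ (1.36): the two (1.29)-form slots and R9 ARE the located inputs `h129`, `h129′`, `hR9` of the tree's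
`B13Lemma1Assembly.bound136_of_129`; with print's splitting `V′_k(Y) = W₁(Y) + W₂(Y)` (`h133`), non-negative letters and a
choice of the constants of record `C₁`, `C₂` dominating the two printed prefactors (`hC` — *«There exist absolute constants
C₁, C₂, q, for which (1.36)»*), the bundle re-derives Lemma 1's bound (1.36).  PROVED by name (a consistency knit; (1.36)
is also the conjunct `lem1`). [cite: Balaban1988RG2Cluster, Lemma 1 (1.36) p.9] -/
theorem Hyp.bound136_rederived (h : Hyp S c X) (h133 : ∀ Y, S.Vp Y = X.W₁ Y + X.W₂ Y) (hE : 0 ≤ c.E₀)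
    (hε : 0 ≤ c.ε₁) (hA : 0 ≤ X.A) (hM : 0 ≤ c.M)
    (hC : c.E₀ * c.ε₁ * (X.A * c.M ^ c.q) * Real.exp (X.A' * c.κ₁) +
        c.E₀ * c.ε₁ * (X.A₂ * c.M ^ c.q) * Real.exp (X.A₂' * c.κ₁) ≤
      c.E₀ * c.ε₁ * c.C₁ * c.M ^ c.q * Real.exp (c.C₂ * c.κ₁)) :
    B13.Bound136 S c S.Vp := by
  have hP₁ : 0 ≤ c.E₀ * c.ε₁ * (X.A * c.M ^ c.q) * Real.exp (X.A' * c.κ₁) := by positivity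
  exact B13Lemma1Assembly.bound136_of_129 S c X.W₁ X.W₂ hP₁ h133 h.b129 h.b129p h.r136 hC

/-- KNIT (1.31) ⇒ (1.32) p. 9: the slot `Restr132Printed` supplies the provisos `hR8`, `hδ1` of the tree's kernel form
`B13Sect1Arith.bound_132` — given the scaling input (1.31) (`h131`, `ℓ = L^jη ≦ 1`), the geometric input
`d_k(Y) ≦ d_k(X₀) + 4M⁻⁴|Y∖X₀|` (`hG1`, census G1) and `κ ≧ 0`, the last two exponentials of (1.30) are bounded by (1.32).
PROVED by name. [cite: Balaban1988RG2Cluster, (1.32) p.9] -/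
theorem Restr132Printed.ineq132 (h : Restr132Printed c) (hκ : 0 ≤ c.κ) {n dY dX0 djX ℓ : ℝ} (hℓ1 : ℓ ≤ 1)
    (hdj : 0 ≤ djX) (h131 : dX0 ≤ ℓ * djX) (hn : 0 ≤ n) (hG1 : dY ≤ dX0 + 4 * n) :
    Real.exp (-(c.κ₁ - 1) * n) * Real.exp (-(c.κ * djX)) ≤
      Real.exp (-(1 - c.δ) * c.κ * dY - c.δ * c.κ * djX) :=
  B13Sect1Arith.bound_132 hκ h.2.2 h.1 hℓ1 hdj h131 hn hG1

/-- KNIT p. 9 × p. 21: the printed range `0 < δ < 1` of `Restr132Printed` is implied by the assumption of record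
`B13.Consts.R22` (p. 21 *«(1 − 10δ)½L = 1»*, giving `0 < δ < 1∕10` for `L > 2`: `B13.Consts.delta_bounds_of_R22`) — so
under R22 the slot reduces to its first clause R8. PROVED by name. [cite: Balaban1988RG2Cluster, (1.32) p.9 and p.21] -/
theorem restr132_of_R8_R22 (hR8 : (1 - c.δ) * c.κ ≤ (1 / 4) * (c.κ₁ - 1)) (hL : 2 < (c.L : ℝ)) (h22 : c.R22) :
    Restr132Printed c := by
  obtain ⟨h0, h1⟩ := B13.Consts.delta_bounds_of_R22 c hL h22
  exact ⟨hR8, h0, by linarith⟩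

/-- KNIT p. 9: the slot `Restr136Printed` is the `hR9` of the tree's `B13Sect1Arith.rate_R9` — the (1.29)-rate `(1∕16)κ₁`
dominates the (1.36)-rate `(1 − 2δ)κ` on every `d ≧ 0`. PROVED by name. [cite: Balaban1988RG2Cluster, p.9 (before Lemma 1)] -/
theorem Restr136Printed.rate136 (h : Restr136Printed c) {d : ℝ} (hd : 0 ≤ d) :
    Real.exp (-(1 / 16) * c.κ₁ * d) ≤ Real.exp (-(1 - 2 * c.δ) * c.κ * d) :=
  B13Sect1Arith.rate_R9 hd h

/-- KNIT p. 9: the conjunct `cube9` gives the located input `hc` of `B13Lemma1Eq130.boundP9_of_130` for any family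
`Sc Y` of admissible cubes □ ⊂ Y (at most the M⁻⁴|Y| cubes of Y, `hSc`). PROVED. [cite: Balaban1988RG2Cluster, p.9 (after (1.32))] -/
theorem Hyp.hc (h : Hyp S c X) {α : Type*} (Sc : S.Dk.Dom → Finset α) (hSc : ∀ Y, (Sc Y).card ≤ S.volk Y) :
    ∀ Y, ((Sc Y).card : ℝ) ≤ Real.exp (c.δ * c.κ * S.Dk.dj Y) :=
  h.cube9.of_count_le hSc

/-- KNIT (1.38)-analyticity + (1.39) ⇒ (1.40) in the sharp form: the conjuncts `an138`, `i139` ARE the located inputs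
`hF`, `h139` of the tree's `B13Ineq140.ineq140_sharp` (Cauchy estimates on the polydisc; `a₁ > 0`, `C₃ ≧ 0`). PROVED by
name. [cite: Balaban1988RG2Cluster, (1.39)–(1.40) p.10] -/
theorem Hyp.ineq140_sharp (h : Hyp S c X) (ha₁ : 0 < X.a₁) (hC₃ : 0 ≤ c.C₃) (t : X.T) {B' : E}
    (hB' : Real.exp (16 * c.κ₁) * ‖B'‖ ≤ X.a₁ / 3) {u v : E} (hu : ‖u‖ ≤ 1) (hv : ‖v‖ ≤ 1) :
    ‖B13Ineq140.coeff140 (X.Fk t) B' u v‖ ≤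
      1 / 2 * c.C₃ * 3 ^ 3 * Real.exp (48 * c.κ₁) * (c.M ^ 4 * Real.exp (-(c.κ₁ - 1) * X.nYc t)) * ‖B'‖ :=
  B13Ineq140.ineq140_sharp ha₁ hC₃ (h.an138 t) (h.i139 t) hB' hu hv

/-- KNIT (1.39) ⇒ (1.40) as printed, re-derived: with `M⁻⁴|Y∖□| = M⁻⁴|Y| − 1` (`hn`: the admissible cube □ ⊂ Y is one
of the M⁻⁴|Y| cubes of Y), `κ₁ ≧ 1`, `d_k(Y) ≦ 4M⁻⁴|Y|` (⇐ (2.30), `B13Ineq140.four_n_of_230`) and the absorption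
hypothesis R10 `M⁴e^{κ₁−1} ≦ e^{8κ₁}` of `B13Ineq140.absorb140`, the conjuncts `an138`, `i139` give back the conjunct
`i140`'s statement through the tree's `B13Ineq140.ineq140Printed_of_139`.  PROVED by name (a consistency knit, as for
(1.36)). [cite: Balaban1988RG2Cluster, (1.39)–(1.40) p.10] -/
theorem Hyp.ineq140_rederived (h : Hyp S c X) (t : X.T) (ha₁ : 0 < X.a₁) (hC₃ : 0 ≤ c.C₃) (hκ : 1 ≤ c.κ₁)
    (hd : S.Dk.dj (X.Ydom t) ≤ 4 * (S.volk (X.Ydom t) : ℝ))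
    (hR10 : c.M ^ 4 * Real.exp (c.κ₁ - 1) ≤ Real.exp (8 * c.κ₁))
    (hn : X.nYc t = (S.volk (X.Ydom t) : ℝ) - 1) :
    B13Ineq140.Ineq140Printed (X.Fk t) c.κ₁ X.a₁ c.C₃ (S.Dk.dj (X.Ydom t)) (S.volk (X.Ydom t) : ℝ) := by
  have h139 := h.i139 t
  rw [hn] at h139
  exact B13Ineq140.ineq140Printed_of_139 ha₁ hC₃ hκ hd hR10 (h.an138 t) h139

end Bookkeeping

/-! ## §4 v1.1 (check-3 g2 M-c3-3): the USED form of the p. 9 □-count bound, the refutation of the v1 record on the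
tree's own carriers, its model there, and the corrected bundle `Hyp1` (append-only: nothing above is changed) -/

section V11

open B13ScaleTransfer TreeLengthCubeSystem B13Ineq230Printed

/-- **p. 9 [PDF 9] ll. 16–18 in the regime in which print uses it**, verbatim: *«Finally, the sum over all possible cubes
□ can be bounded by M⁻⁴|Y| ≦ 3·2³d_k(Y) ≦ exp δκd_k(Y).»* (p. 9 l. 14 *«for δκ sufficiently large»*), read with p. 8
[PDF 8] ll. 7–8, verbatim: *«The number O(1) is in fact small, because we sum over X with d_j(X) ≠ 0, as it follows from
our inductive construction.»* — the USED consequence: for every localization domain `Y` of the construction's sums, i.e.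
with `d_k(Y) ≠ 0` ⇔ `1 ≦ d_k(Y)` (d_k is the length of a shortest tree graph *«formed by edges of cubes»*, [Balaban1987RG1]
p. 257 ll. 29–31 — an integer; the tree's `1 ≤ D.dj Y` of `B13Ineq230Printed.count_le_exp_sys` ∕
`eq128_second_of_one_le` ∕ `B13Sect1Statements.eq128_of_lower230`), the number `cnt Y` of terms of the □-sum is
`≦ exp δκd_k(Y)`.  This is the binder `hc` of `B13Lemma1Eq130.boundP9_of_130` on those domains (`Hyp1.hc`; all domains:
`Hyp1.hc_all`), and — unlike the record `CubeSumP9Printed` over every domain — it HOLDS on the tree's own carriers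
(`cubeSumP9Used_sys`).  The threshold *«δκ sufficiently large»* is the instance's (on `sys B`: `δκ ≧ log(8·2^d)`).
[cite: Balaban1988RG2Cluster, p.9 (after (1.32)) with p.8 ll.7–8] -/
def CubeSumP9UsedPrinted (D : LocDomainSys) (cnt : D.Dom → ℕ) (δ κ : ℝ) : Prop :=
  ∀ Y : D.Dom, 1 ≤ D.dj Y → (cnt Y : ℝ) ≤ Real.exp (δ * κ * D.dj Y)

/-- The record over every domain implies the used form. [cite: Balaban1988RG2Cluster, p.9 (after (1.32))] -/
theorem CubeSumP9Printed.used {D : LocDomainSys} {cnt : D.Dom → ℕ} {δ κ : ℝ} (h : CubeSumP9Printed D cnt δ κ) :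
    CubeSumP9UsedPrinted D cnt δ κ :=
  fun Y _ => h Y

/-- A □-sum with at most `vol Y` terms inherits the used bound (the admissible cubes □ ⊂ Y are among the M⁻⁴|Y| cubes of
Y). [cite: Balaban1988RG2Cluster, p.9 (after (1.32))] -/
theorem CubeSumP9UsedPrinted.of_count_le {D : LocDomainSys} {vol cnt : D.Dom → ℕ} {δ κ : ℝ}
    (h : CubeSumP9UsedPrinted D vol δ κ) (hle : ∀ Y, cnt Y ≤ vol Y) : CubeSumP9UsedPrinted D cnt δ κ :=
  fun Y hY => le_trans (by exact_mod_cast hle Y) (h Y hY)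

/-- **The v1 record conjunct is FALSE at any degenerate domain with two or more terms** (check-3 g2 M-c3-3): if
`d_k(Y) = 0` and `2 ≦ cnt Y`, then `CubeSumP9Printed` demands `2 ≦ e⁰ = 1`. PROVED. [cite: Balaban1988RG2Cluster, p.9 (after (1.32))] -/
theorem not_cubeSumP9Printed_of_degenerate (D : LocDomainSys) (cnt : D.Dom → ℕ) (δ κ : ℝ) (Y : D.Dom)
    (hY : D.dj Y = 0) (h2 : 2 ≤ cnt Y) : ¬ CubeSumP9Printed D cnt δ κ := by
  intro h
  have h1 := h Y
  rw [hY, mul_zero, Real.exp_zero] at h1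
  have h3 : (2 : ℝ) ≤ (cnt Y : ℝ) := by exact_mod_cast h2
  linarith

variable {d : ℕ}

/-- **On the tree's own carriers** — the concrete system `TreeLengthCubeSystem.sys B` of the localization domains of a
window `B` ([Balaban1987RG1] p. 257 ll. 13–25: the non-empty families of cubes *«such that two consecutive cubes have a
common wall»*; d_k = `TreeLength.treeLen`) with the cube count `B13Ineq230Printed.count B` = M⁻⁴|Y| — the record
`CubeSumP9Printed` FAILS for every δ, κ as soon as `B` has two cubes with a common wall: the two-cube domain
`B13Ineq230Printed.pair` has two cubes and d_k = 0 (`count_pair`, `dj_pair`: one point of the common wall meets both closed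
cubes; the companion of `B13Ineq230Printed.ineq230Lower_fails_at_pair`, cell GAPS G-B13-07).  PROVED.
[cite: Balaban1988RG2Cluster, p.9 (after (1.32)); Balaban1987RG1, p.257 (localization domains)] -/
theorem not_cubeSumP9Printed_sys (B : Finset (Pt d)) (a b : Pt d) (ha : a ∈ B) (hb : b ∈ B) (h : Adj a b) (δ κ : ℝ) :
    ¬ CubeSumP9Printed (sys B) (count B) δ κ :=
  not_cubeSumP9Printed_of_degenerate _ _ δ κ (pair B a b ha hb h) (dj_pair B a b ha hb h) (by rw [count_pair])

/-- **The v1 bundle `Hyp` is UNSATISFIABLE on faithful carriers** (check-3 g2 M-c3-3): for any step data `S` whose system of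
localization domains has a domain `Y` with `d_k(Y) = 0` and cube count `M⁻⁴|Y| ≧ 2` (e.g. `S.Dk = sys B`, `S.volk = count B`
with two adjacent cubes in `B`), `Hyp S c X` is false for every `c` and every `X`.  PROVED — the reason v1.1 adds `Hyp1`.
[cite: Balaban1988RG2Cluster, p.9 (after (1.32))] -/
theorem not_hyp_of_degenerate (S : B13.StepData) (c : B13.Consts) {E F : Type*} [NormedAddCommGroup E]
    [NormedSpace ℂ E] [NormedAddCommGroup F] [NormedSpace ℂ F] (X : Carriers S E F) (Y : S.Dk.Dom)
    (hY : S.Dk.dj Y = 0) (h2 : 2 ≤ S.volk Y) : ¬ Hyp S c X := fun h =>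
  not_cubeSumP9Printed_of_degenerate S.Dk S.volk c.δ c.κ Y hY h2 h.cube9

/-- **The used form HOLDS on the tree's own carriers** once *«δκ sufficiently large»* is `δκ ≧ log(8·2^d)` (d = 4:
`δκ ≧ log 128`): on `sys B` with the cube count `count B`, every domain with `1 ≦ d_k(Y)` has `M⁻⁴|Y| ≦ exp δκd_k(Y)` —
the tree's `B13Ineq230Printed.count_le_exp_sys` (repaired lower half of (2.30) and `B13Sect1Arith.bound_128_repaired`) at
`κ₁ := 16δκ + 2`.  PROVED: the corrected conjunct is satisfiable where the bundle is meant to be instantiated.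
[cite: Balaban1988RG2Cluster, p.9 (after (1.32)); Balaban1988RG2Cluster, (2.30) p.18] -/
theorem cubeSumP9Used_sys (B : Finset (Pt d)) {δ κ : ℝ} (hδκ : Real.log (8 * 2 ^ d) ≤ δ * κ) :
    CubeSumP9UsedPrinted (sys B) (count B) δ κ := by
  intro Y hY
  have hκ : 2 + 16 * Real.log (8 * 2 ^ d) ≤ 16 * (δ * κ) + 2 := by linarith
  have h := count_le_exp_sys Y hY hκ
  have e : (1 / 16 : ℝ) * (16 * (δ * κ) + 2 - 2) = δ * κ := by ring
  rwa [e] at h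

/-- **[Balaban1988RG2Cluster] pp. 8–11 AS ONE HYPOTHESIS, v1.1** (the bundle of CARVE-RULES §2.5, corrected per check-3 g2
M-c3-3) for step data `S`, constants `c` and carriers `X` — the conjuncts of `Hyp` BY THE SAME NAMES with the □-count
conjunct in the USED form: Lemma 1 p. 9 (`B13.Lemma1Printed`); Lemma 2 p. 11 (`B13.Lemma2Printed`); (1.27) p. 8
(`B13Sect1Statements.Eq127`, PROVED in the tree by `Eq127_holds`); the p. 8 cube count for every `Y` and `j ≦ k`
(`CubeCountP8Printed`); (1.29) p. 8 for `W₁` (`Bound129Printed`) and its p. 9 twin for `W₂` (`Bound129pPrinted`); the p. 9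
provisos (`Restr132Printed`, `Restr136Printed`); the p. 9 bound on the □-sum's count at the cube count M⁻⁴|Y| FOR THE
DOMAINS WITH `1 ≦ d_k(Y)` (`CubeSumP9UsedPrinted S.Dk S.volk`; p. 8 ll. 7–8); for every term (1.38): its analyticity in
`B′` p. 10 (`Analytic138Printed`), (1.39) (`B13Ineq140.Ineq139`) and (1.40) (`B13Ineq140.Ineq140Printed`).  (The `1` of
`Hyp1`: v1.1, and the regime `1 ≦ d_k`.)  A `structure … : Prop`, one named field per statement; consumed as
`(h : Hyp1 S c X)` (KEY `stmt-QuantumFields-20543`); never proved here, never asserted; implied by the v1 record bundle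
(`Hyp.toHyp1`).  HONEST SCOPE as for `Hyp`: with carriers chosen freely every conjunct is inhabited by trivial data (zero
functions, empty index types); on the tree's own carriers the conjunct that makes `Hyp` unsatisfiable now HOLDS
(`cubeSumP9Used_sys`); `lem1` ∕ `lem2` are the desk's statements over `S`'s reader-owned fields.  (1.28) and the p. 9
chain ∕ count records are NOT conjuncts. [cite: Balaban1988RG2Cluster, Lemma 1 p.9, Lemma 2 p.11, (1.27)–(1.40) pp.8–10] -/
structure Hyp1 (S : B13.StepData) (c : B13.Consts) {E F : Type*} [NormedAddCommGroup E] [NormedSpace ℂ E]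
    [NormedAddCommGroup F] [NormedSpace ℂ F] (X : Carriers S E F) : Prop where
  /-- Lemma 1 (1.33)–(1.36) p. 9 -/
  lem1 : B13.Lemma1Printed S c
  /-- Lemma 2 (1.41)–(1.43) p. 11 -/
  lem2 : B13.Lemma2Printed S c
  /-- (1.27) p. 8 -/
  eq127 : B13Sect1Statements.Eq127
  /-- p. 8: `#{□′ ∈ π_j : □′ ⊂ □̃²}·(L^jη)⁵ ≦ (6L)⁴L^jη`, `L^jη = L^j(L^k)⁻¹`, for every `Y` and `j ≦ k` -/
  count8 : ∀ Y, ∀ j ∈ Finset.range (X.k + 1),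
    CubeCountP8Printed (X.Sq Y j) (c.L : ℝ) ((c.L : ℝ) ^ j * ((c.L : ℝ) ^ X.k)⁻¹)
  /-- (1.29) p. 8 for the Y-sum of the (1.23)-type terms -/
  b129 : Bound129Printed S c X.W₁ X.A X.A'
  /-- p. 9: the same shape with the rate `(1 − 2δ)κ` for the (I.3.7)-type Y-sum -/
  b129p : Bound129pPrinted S c X.W₂ X.A₂ X.A₂'
  /-- p. 9: `¼(κ₁ − 1) ≧ (1 − δ)κ`, `0 < δ < 1` -/
  r132 : Restr132Printed c
  /-- p. 9: `(1∕16)κ₁ ≧ (1 − 2δ)κ` -/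
  r136 : Restr136Printed c
  /-- p. 9 with p. 8 ll. 7–8: for the domains with `1 ≦ d_k(Y)`, the □-sum over `Y` has `≦ exp δκd_k(Y)` terms (at the
  cube count M⁻⁴|Y|) -/
  cube9 : CubeSumP9UsedPrinted S.Dk S.volk c.δ c.κ
  /-- p. 10: every term (1.38) is analytic in `B′` on the polydisc `e^{16κ₁}|B′| < a₁` -/
  an138 : ∀ t : X.T, Analytic138Printed (X.Fk t) c.κ₁ X.a₁
  /-- (1.39) p. 10, for every term (1.38) -/
  i139 : ∀ t : X.T, B13Ineq140.Ineq139 (X.Fk t) c.κ₁ X.a₁ c.C₃ c.M (X.nYc t)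
  /-- (1.40) p. 10, for every term (1.38) -/
  i140 : ∀ t : X.T, B13Ineq140.Ineq140Printed (X.Fk t) c.κ₁ X.a₁ c.C₃ (S.Dk.dj (X.Ydom t)) (S.volk (X.Ydom t) : ℝ)

variable {S : B13.StepData} {c : B13.Consts} {E F : Type*} [NormedAddCommGroup E] [NormedSpace ℂ E]
  [NormedAddCommGroup F] [NormedSpace ℂ F] {X : Carriers S E F}

/-- The v1 record bundle implies the v1.1 bundle (its □-count conjunct is weakened to the used form; everything else is
identical). [cite: Balaban1988RG2Cluster, p.9 (after (1.32))] -/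
theorem Hyp.toHyp1 (h : Hyp S c X) : Hyp1 S c X :=
  ⟨h.lem1, h.lem2, h.eq127, h.count8, h.b129, h.b129p, h.r132, h.r136, h.cube9.used, h.an138, h.i139, h.i140⟩

/-- Under `Hyp1`: the analyticity clause of Lemma 1 (V′_k(Y) analytic on (1.34)). [cite: Balaban1988RG2Cluster, Lemma 1 p.9] -/
theorem Hyp1.analytic_Vp (h : Hyp1 S c X) (Y : S.Dk.Dom) : S.Analytic (S.Vp Y) (S.sp1 Y) :=
  h.lem1.1 Y

/-- Under `Hyp1`: the bound (1.36) for `V′_k` — a projection of Lemma 1. [cite: Balaban1988RG2Cluster, (1.36) p.9] -/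
theorem Hyp1.bound136_Vp (h : Hyp1 S c X) : B13.Bound136 S c S.Vp :=
  h.lem1.2

/-- Under `Hyp1`: the representation (1.42) — a projection of Lemma 2. [cite: Balaban1988RG2Cluster, (1.42) p.11] -/
theorem Hyp1.repr142 (h : Hyp1 S c X) : B13.Repr142 S :=
  h.lem2.2.1

/-- Under `Hyp1`: the bound (1.43) — a projection of Lemma 2. [cite: Balaban1988RG2Cluster, (1.43) p.11] -/
theorem Hyp1.bound143 (h : Hyp1 S c X) : B13.Bound143 S c :=
  h.lem2.2.2.1

/-- Under `Hyp1`: (1.36) for `V″_k` — a projection of Lemma 2. [cite: Balaban1988RG2Cluster, Lemma 2 p.11] -/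
theorem Hyp1.bound136_Vpp (h : Hyp1 S c X) : B13.Bound136 S c S.Vpp :=
  h.lem2.2.2.2.1

/-- Under `Hyp1`: the gauge-invariance clause of Lemma 2. [cite: Balaban1988RG2Cluster, Lemma 2 p.11] -/
theorem Hyp1.gaugeInv (h : Hyp1 S c X) (Y : S.Dk.Dom) :
    S.GaugeInv (S.V Y) ∧ S.GaugeInv (S.quadForm Y) ∧ S.GaugeInv (S.Vpp Y) :=
  h.lem2.2.2.2.2 Y

/-- KNIT p. 8 under `Hyp1`: the conjunct `count8` IS the located input `hq` of `B13Lemma1Assembly.lemma1Printed_of_sect1`.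
[cite: Balaban1988RG2Cluster, p.8 (after (1.26))] -/
theorem Hyp1.hq (h : Hyp1 S c X) :
    ∀ Y, ∀ j ∈ Finset.range (X.k + 1),
      ((X.Sq Y j).card : ℝ) * ((c.L : ℝ) ^ j * ((c.L : ℝ) ^ X.k)⁻¹) ^ 5 ≤
        (6 * (c.L : ℝ)) ^ 4 * ((c.L : ℝ) ^ j * ((c.L : ℝ) ^ X.k)⁻¹) :=
  h.count8

/-- KNIT p. 9 ⇒ (1.36) under `Hyp1` (as `Hyp.bound136_rederived`): the (1.29)-form slots and R9 feed the tree's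
`B13Lemma1Assembly.bound136_of_129`. PROVED by name. [cite: Balaban1988RG2Cluster, Lemma 1 (1.36) p.9] -/
theorem Hyp1.bound136_rederived (h : Hyp1 S c X) (h133 : ∀ Y, S.Vp Y = X.W₁ Y + X.W₂ Y) (hE : 0 ≤ c.E₀)
    (hε : 0 ≤ c.ε₁) (hA : 0 ≤ X.A) (hM : 0 ≤ c.M)
    (hC : c.E₀ * c.ε₁ * (X.A * c.M ^ c.q) * Real.exp (X.A' * c.κ₁) +
        c.E₀ * c.ε₁ * (X.A₂ * c.M ^ c.q) * Real.exp (X.A₂' * c.κ₁) ≤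
      c.E₀ * c.ε₁ * c.C₁ * c.M ^ c.q * Real.exp (c.C₂ * c.κ₁)) :
    B13.Bound136 S c S.Vp := by
  have hP₁ : 0 ≤ c.E₀ * c.ε₁ * (X.A * c.M ^ c.q) * Real.exp (X.A' * c.κ₁) := by positivity
  exact B13Lemma1Assembly.bound136_of_129 S c X.W₁ X.W₂ hP₁ h133 h.b129 h.b129p h.r136 hC

/-- KNIT p. 9 under `Hyp1`: the conjunct `cube9` gives the located input `hc` of `B13Lemma1Eq130.boundP9_of_130` AT THE
DOMAINS WITH `1 ≦ d_k(Y)`, for any family `Sc Y` of admissible cubes □ ⊂ Y (at most the M⁻⁴|Y| cubes of Y, `hSc`).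
PROVED. [cite: Balaban1988RG2Cluster, p.9 (after (1.32))] -/
theorem Hyp1.hc (h : Hyp1 S c X) {α : Type*} (Sc : S.Dk.Dom → Finset α) (hSc : ∀ Y, (Sc Y).card ≤ S.volk Y) :
    ∀ Y, 1 ≤ S.Dk.dj Y → ((Sc Y).card : ℝ) ≤ Real.exp (c.δ * c.κ * S.Dk.dj Y) :=
  h.cube9.of_count_le hSc

/-- KNIT p. 9 × p. 8 ll. 7–8 under `Hyp1`: the FULL binder `hc` of `B13Lemma1Eq130.boundP9_of_130` (over every domain)
follows for every cube family `Sc` that is indexed as in the construction — at most the M⁻⁴|Y| cubes of Y (`hSc`) and, at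
the degenerate domains `d_k(Y) < 1` (outside the construction's sums, *«we sum over X with d_j(X) ≠ 0»*), empty or a
single cube (`hdeg`; there `#Sc(Y) ≦ 1 ≦ e^{δκd_k(Y)}` since `δκ ≧ 0`, `d_k ≧ 0`).  PROVED. [cite: Balaban1988RG2Cluster, p.9 (after (1.32)) with p.8 ll.7–8] -/
theorem Hyp1.hc_all (h : Hyp1 S c X) (hδκ : 0 ≤ c.δ * c.κ) {α : Type*} (Sc : S.Dk.Dom → Finset α)
    (hSc : ∀ Y, (Sc Y).card ≤ S.volk Y) (hdeg : ∀ Y, S.Dk.dj Y < 1 → (Sc Y).card ≤ 1) :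
    ∀ Y, ((Sc Y).card : ℝ) ≤ Real.exp (c.δ * c.κ * S.Dk.dj Y) := by
  intro Y
  by_cases hY : 1 ≤ S.Dk.dj Y
  · exact h.hc Sc hSc Y hY
  · have h1 : ((Sc Y).card : ℝ) ≤ 1 := by exact_mod_cast hdeg Y (lt_of_not_ge hY)
    have h0 : 0 ≤ c.δ * c.κ * S.Dk.dj Y := mul_nonneg hδκ (S.Dk.dj_nonneg Y)
    have h2 : c.δ * c.κ * S.Dk.dj Y + 1 ≤ Real.exp (c.δ * c.κ * S.Dk.dj Y) := Real.add_one_le_exp _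
    linarith

/-- KNIT (1.38)-analyticity + (1.39) ⇒ (1.40) in the sharp form under `Hyp1` (as `Hyp.ineq140_sharp`). PROVED by name.
[cite: Balaban1988RG2Cluster, (1.39)–(1.40) p.10] -/
theorem Hyp1.ineq140_sharp (h : Hyp1 S c X) (ha₁ : 0 < X.a₁) (hC₃ : 0 ≤ c.C₃) (t : X.T) {B' : E}
    (hB' : Real.exp (16 * c.κ₁) * ‖B'‖ ≤ X.a₁ / 3) {u v : E} (hu : ‖u‖ ≤ 1) (hv : ‖v‖ ≤ 1) :
    ‖B13Ineq140.coeff140 (X.Fk t) B' u v‖ ≤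
      1 / 2 * c.C₃ * 3 ^ 3 * Real.exp (48 * c.κ₁) * (c.M ^ 4 * Real.exp (-(c.κ₁ - 1) * X.nYc t)) * ‖B'‖ :=
  B13Ineq140.ineq140_sharp ha₁ hC₃ (h.an138 t) (h.i139 t) hB' hu hv

/-- KNIT (1.39) ⇒ (1.40) as printed, re-derived under `Hyp1` (as `Hyp.ineq140_rederived`). PROVED by name.
[cite: Balaban1988RG2Cluster, (1.39)–(1.40) p.10] -/
theorem Hyp1.ineq140_rederived (h : Hyp1 S c X) (t : X.T) (ha₁ : 0 < X.a₁) (hC₃ : 0 ≤ c.C₃) (hκ : 1 ≤ c.κ₁)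
    (hd : S.Dk.dj (X.Ydom t) ≤ 4 * (S.volk (X.Ydom t) : ℝ))
    (hR10 : c.M ^ 4 * Real.exp (c.κ₁ - 1) ≤ Real.exp (8 * c.κ₁))
    (hn : X.nYc t = (S.volk (X.Ydom t) : ℝ) - 1) :
    B13Ineq140.Ineq140Printed (X.Fk t) c.κ₁ X.a₁ c.C₃ (S.Dk.dj (X.Ydom t)) (S.volk (X.Ydom t) : ℝ) := by
  have h139 := h.i139 t
  rw [hn] at h139
  exact B13Ineq140.ineq140Printed_of_139 ha₁ hC₃ hκ hd hR10 (h.an138 t) h139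

end V11

end

end Literature.MathematicalPhysics.QuantumFieldTheory.Balaban1983to89.B13Carve28Lemmas1to2Hyp
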